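import Summits.HubbardSuperconductivity.HubbardSuperconductivity.Theorems.ParentFirstSMADiluteDWavePairsCondenseNormalForm
import Summits.HubbardSuperconductivity.HubbardSuperconductivity.Theorems.ParentFirstSMADiluteDWavePairsCondenseDichotomy
import Summits.HubbardSuperconductivity.HubbardSuperconductivity.Theorems.NoGoNogoThesis
import Literature.MathematicalPhysics.QuantumLattice.ApproximateEigenvectorLemmas
import Literature.MathematicalPhysics.QuantumLattice.UncertaintyPrincipleInequality
import HarnessLib

/-!
# STRATEGY CENSUS r1 — typed attempts (crux `DiluteDWavePairsCondense`, stmt-HubbardSuperconductivity-10771)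

Companion Lean file of the REDIRECT strategist census `Cruxes/DiluteDWavePairsCondense/STRATEGY-CENSUS.md`
(part r1, unit `cstrat-stmt-HubbardSuperconductivity-10771-r1`; independent of the s1 census and of its
`STRATEGY_CENSUS.lean`, which is not imported). Everything here is sorry-free; the `def`s are the typed
forms of the attempts (abbreviations of literal route sub-terms, one sibling statement, two strengthenings,
two splits, the negation shape); the theorems are the proved glue / sandwich facts quoted in the census.
Nothing here is a tree obligation: this is a crux WORKFILE (`ledger crux write`), not a `Theorems/` file —
the tribunal-facing sandwich is landed separately as
`Theorems/ParentFirstSMADiluteDWavePairsCondenseSummitStrength.lean` (p171002).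

Contents
* §0 names: `HA HB HC Pkg SummitAt EveryGSOrder WindowSummit`, `crux_iff_window`, the sandwich
  `crux_of_windowSummit` / `summit_of_windowSummit` / `crux_iff_windowSummit_of_pkg` (T1 route (a)).
* Transfer TR-A: `AttractiveOnsiteLROHalfFilled U` — the solved-sibling candidate two rungs down
  (attractive `U < 0`, `s`-wave on-site pair, half filling): typed, and OPEN in print for every `U < 0`.
* Strengthen ST-A: `GroundToGround U δ` (ground-to-ground `d`-wave coherence at density `δ`, the
  hypothesis (c) transported from `(L², L²-2)` to `(N_L, N_L-2)` with the condensate scaling `L⁴`);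
  `everyGSOrder_of_groundToGround` (PROVED, Cauchy–Schwarz), `crux_of_groundToGroundWindow`.
* Strengthen ST-B: `FiniteSizeCriterion` (schema; no instance without an infrared bound).
* Decomposition DE-A: `Coercive`, `LegendreFloor`; `everyGSOrder_of_legendre` (PROVED, AM–GM): a
  susceptibility floor `a L⁶` against any `g/L²`-coercive comparison operator gives order `a g L⁴`.
* Decomposition (s1 D6, re-typed for the probes): `CruxOn a b`, `crux_iff_cruxOn`, `cruxOn_split`,
  `cruxOn_of_crux`.
* Negation NE: `DarkLitPoint`, `not_crux_iff_exists_darkLitPoint`.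
[folklore]
-/

set_option linter.dupNamespace false

noncomputable section

namespace Summit.HubbardSuperconductivity.HubbardSuperconductivity.Cruxes.DiluteDWavePairsCondense.CensusR1

open Matrix Finset Filter
open Literature.Probability.LatticeModels Literature.MathematicalPhysics.QuantumLattice
open Summit.HubbardSuperconductivity.HubbardSuperconductivity.Theses.ParentFirstSMA
open Summit.HubbardSuperconductivity.TwTipContinuation.Negative (summitMatrix_of_everyGSOrder everyGSOrder_of_summitMatrix)
open scoped ComplexOrder

/-! ## §0 Names for the literal sub-terms of the crux, and the sandwich -/

/-- (a) uniform half-filled charge gap at `U`. [folklore] -/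
def HA (U : ℝ) : Prop :=
  ∃ g : ℝ, 0 < g ∧ ∃ L₀ : ℕ, ∀ L : ℕ, L₀ ≤ L → Even L → g ≤ chargeGap (fermionTorusGraph 2 L) 1 U (L ^ 2)

/-- (b) uniform two-hole binding at `U`. [folklore] -/
def HB (U : ℝ) : Prop :=
  ∃ b : ℝ, 0 < b ∧ ∃ L₀ : ℕ, ∀ L : ℕ, L₀ ≤ L → Even L →
    b ≤ 2 * groundEnergyAt (fermionTorusGraph 2 L) 1 U (L ^ 2 - 1) -
      groundEnergyAt (fermionTorusGraph 2 L) 1 U (L ^ 2) - groundEnergyAt (fermionTorusGraph 2 L) 1 U (L ^ 2 - 2)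

/-- (c) `d_{x²-y²}` coherence of the bound pair at `U`. [folklore] -/
def HC (U : ℝ) : Prop :=
  ∃ z : ℝ, 0 < z ∧ ∃ L₀ : ℕ, ∀ (L : ℕ) [NeZero L], L₀ ≤ L → Even L →
    ∃ φ₂ ψ₀ : Fock (Orb (FermionTorus 2 L)), IsGroundState (hubbardTorus 2 L 1 U) (L ^ 2 - 2) φ₂ ∧
      star φ₂ ⬝ᵥ φ₂ = 1 ∧ IsGroundState (hubbardTorus 2 L 1 U) (L ^ 2) ψ₀ ∧ star ψ₀ ⬝ᵥ ψ₀ = 1 ∧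
        z * (L : ℝ) ^ 2 ≤ ‖star φ₂ ⬝ᵥ (pairField dWaveFormFactor L *ᵥ ψ₀)‖ ^ 2

/-- The zero-, one- and two-hole PACKAGE at `U`. [folklore] -/
def Pkg (U : ℝ) : Prop := HA U ∧ HB U ∧ HC U

/-- The summit's matrix at `(U, δ)` (word for word). [folklore] -/
def SummitAt (U δ : ℝ) : Prop :=
  ∀ (N : ℕ → ℕ) (ψ : ∀ L, Fock (Orb (FermionTorus 2 L))),
    (∀ L, Even L → N L = 2 * ⌊(1 - δ) * (L : ℝ) ^ 2 / 2⌋₊ ∧ star (ψ L) ⬝ᵥ ψ L = 1 ∧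
        IsGroundStateInSector (hubbardTorus 2 L 1 U) (N L) 0 (ψ L)) →
      HasLongRangeOrder (fun k => halfOpenBox 2 (2 * k))
        (fun k => torusPullback (pairFieldCorr dWaveFormFactor ψ) (2 * k))

/-- The every-ground-state order bound of the pure torus at `(U, δ)` (normal form of `SummitAt`,
`summitMatrix_iff_everyGSOrder`). [folklore] -/
def EveryGSOrder (U δ : ℝ) : Prop :=
  ∃ c : ℝ, 0 < c ∧ ∃ L₀ : ℕ, ∀ (L : ℕ) [NeZero L], L₀ ≤ L → Even L →
    ∀ ψ : Fock (Orb (FermionTorus 2 L)), star ψ ⬝ᵥ ψ = 1 →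
      IsGroundStateInSector (hubbardTorus 2 L 1 U) (2 * ⌊(1 - δ) * (L : ℝ) ^ 2 / 2⌋₊) 0 ψ →
        c * (L : ℝ) ^ 4 ≤ (expect ((pairField dWaveFormFactor L)ᴴ * pairField dWaveFormFactor L) ψ).re

/-- `H` — the summit asserted at EVERY `U` of the strong-coupling window. [folklore] -/
def WindowSummit : Prop :=
  ∀ U : ℝ, 12 ≤ U → U ≤ 24 → ∃ δ ∈ Set.Ioo (0 : ℝ) (1 / 2), SummitAt U δ

/-- The crux with names inserted. [folklore] -/
theorem crux_iff_window :
    DiluteDWavePairsCondense ↔ ∀ U : ℝ, 12 ≤ U → U ≤ 24 → Pkg U → ∃ δ ∈ Set.Ioo (0 : ℝ) (1 / 2), SummitAt U δ :=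
  ⟨fun h U h12 h24 hP => h U h12 h24 hP.1 hP.2.1 hP.2.2,
    fun h U h12 h24 hA hB hC => h U h12 h24 ⟨hA, hB, hC⟩⟩

/-- `H ⇒ C`. [folklore] -/
theorem crux_of_windowSummit (h : WindowSummit) : DiluteDWavePairsCondense :=
  crux_iff_window.2 fun U h12 h24 _ => h U h12 h24

/-- `H ⇒ S` alone (`U := 12`). [folklore] -/
theorem summit_of_windowSummit (h : WindowSummit) : _root_.HubbardSuperconductivity := by
  obtain ⟨δ, hδ, hS⟩ := h 12 le_rfl (by norm_num)
  exact ⟨12, by norm_num, δ, hδ, hS⟩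

/-- Under the package on the whole window, `C ⟺ H`. [folklore] -/
theorem crux_iff_windowSummit_of_pkg (hP : ∀ U : ℝ, 12 ≤ U → U ≤ 24 → Pkg U) :
    DiluteDWavePairsCondense ↔ WindowSummit :=
  ⟨fun h U h12 h24 => crux_iff_window.1 h U h12 h24 (hP U h12 h24), crux_of_windowSummit⟩

/-- `C` plus the package at one `U` is `S`. [folklore] -/
theorem summit_of_crux_of_pkgAt (h : DiluteDWavePairsCondense) {U : ℝ} (h12 : 12 ≤ U) (h24 : U ≤ 24)
    (hP : Pkg U) : _root_.HubbardSuperconductivity := by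
  obtain ⟨δ, hδ, hS⟩ := crux_iff_window.1 h U h12 h24 hP
  exact ⟨U, by linarith, δ, hδ, hS⟩

/-- Pointwise normal form: `SummitAt U δ ↔ EveryGSOrder U δ` for `δ > 0` (tree). [folklore] -/
theorem summitAt_iff_everyGSOrder {U δ : ℝ} (hδ : 0 ≤ δ) : SummitAt U δ ↔ EveryGSOrder U δ :=
  ⟨everyGSOrder_of_summitMatrix (by linarith), summitMatrix_of_everyGSOrder⟩

/-! ## Transfer TR-A — the attractive / `s`-wave / half-filled sibling (typed; OPEN for every `U < 0`) -/

/-- **Sibling statement two rungs down.** On-site `s`-wave pair-field LRO (`sWave` form factor) of EVERY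
normalised half-filled `S^z = 0` ground-state sequence of the ATTRACTIVE torus `hubbardTorus 2 L 1 U`,
`U < 0`. By the Shiba (partial particle–hole) map this is the three-axis antiferromagnetic LRO of the
repulsive half-filled model, open in print in every dimension for the Hubbard model (for spins: 2D
`S = 1/2` Néel ground-state order is open, Kennedy–Lieb–Shastry 1988). Recorded as the calibration point
of the census: the crux sits at least three rungs above it (repulsive ↦ attractive, `d` ↦ `s`,
`δ > 0` ↦ half filling). [folklore] -/
def AttractiveOnsiteLROHalfFilled (U : ℝ) : Prop :=
  ∀ ψ : ∀ L, Fock (Orb (FermionTorus 2 L)),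
    (∀ L, Even L → star (ψ L) ⬝ᵥ ψ L = 1 ∧ IsGroundStateInSector (hubbardTorus 2 L 1 U) (L ^ 2) 0 (ψ L)) →
      HasLongRangeOrder (fun k => halfOpenBox 2 (2 * k))
        (fun k => torusPullback (pairFieldCorr sWave ψ) (2 * k))

/-! ## Strengthen ST-A — ground-to-ground `d`-wave coherence at density `δ` -/

/-- **`S⁺` (Anderson-tower form of the order).** Eventually in even `L`, for EVERY unit ground state `ψ`
of the sector `(N_L, 0)`, `N_L = 2⌊(1-δ)L²/2⌋`, and EVERY unit ground state `φ` of the sector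
`(N_L - 2, 0)`, the `d`-wave pair field connects them macroscopically:
`c L⁴ ≤ |⟨φ, Δ_d ψ⟩|²`. This is hypothesis (c) of the crux transported from the pair of sectors
`(L², L² - 2)` (ONE pair, scaling `L²`) to `(N_L, N_L - 2)` (a condensate, scaling `L⁴`). [folklore] -/
def GroundToGround (U δ : ℝ) : Prop :=
  ∃ c : ℝ, 0 < c ∧ ∃ L₀ : ℕ, ∀ (L : ℕ) [NeZero L], L₀ ≤ L → Even L →
    ∀ ψ φ : Fock (Orb (FermionTorus 2 L)), star ψ ⬝ᵥ ψ = 1 →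
      IsGroundStateInSector (hubbardTorus 2 L 1 U) (2 * ⌊(1 - δ) * (L : ℝ) ^ 2 / 2⌋₊) 0 ψ →
        star φ ⬝ᵥ φ = 1 →
          IsGroundStateInSector (hubbardTorus 2 L 1 U) (2 * (⌊(1 - δ) * (L : ℝ) ^ 2 / 2⌋₊ - 1)) 0 φ →
            c * (L : ℝ) ^ 4 ≤ ‖star φ ⬝ᵥ (pairField dWaveFormFactor L *ᵥ ψ)‖ ^ 2

/-- **`S⁺ ⇒` every-GS order** (`δ ≥ -1`): a ground state of the two-hole-doped sector exists
(`NoGo.exists_unit_groundStateInSector_hubbardTorus`) and `|⟨φ, Δψ⟩|² ≤ ‖Δψ‖² = re⟨ψ, Δ†Δ ψ⟩` for a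
unit `φ` (Cauchy–Schwarz). The strengthening is STRICT (it pins the condensate matrix element on the
sector ground states, not on some low-lying tower state). [folklore] -/
theorem everyGSOrder_of_groundToGround {U δ : ℝ} (hδ : -1 ≤ δ) (h : GroundToGround U δ) :
    EveryGSOrder U δ := by
  obtain ⟨c, hc, L₀, hL⟩ := h
  refine ⟨c, hc, L₀, fun L _ hL₀ hE ψ hψ hgs => ?_⟩
  have hn : ⌊(1 - δ) * (L : ℝ) ^ 2 / 2⌋₊ - 1 ≤ L ^ 2 :=
    (Nat.sub_le _ _).trans (NoGo.floor_pairNumber_le δ hδ L)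
  obtain ⟨φ, hφ, hφgs⟩ := NoGo.exists_unit_groundStateInSector_hubbardTorus L 1 U hn
  have key := hL L hL₀ hE ψ φ hψ hgs hφ hφgs
  have hcs : ‖star φ ⬝ᵥ (pairField dWaveFormFactor L *ᵥ ψ)‖ ≤ eucNorm (pairField dWaveFormFactor L *ᵥ ψ) :=
    norm_star_dotProduct_le_eucNorm hφ _
  calc c * (L : ℝ) ^ 4 ≤ ‖star φ ⬝ᵥ (pairField dWaveFormFactor L *ᵥ ψ)‖ ^ 2 := key
    _ ≤ eucNorm (pairField dWaveFormFactor L *ᵥ ψ) ^ 2 := by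
        gcongr
    _ = (expect ((pairField dWaveFormFactor L)ᴴ * pairField dWaveFormFactor L) ψ).re := by
        simp only [Literature.MathematicalPhysics.QuantumLattice.expect]
        exact (re_expect_conjTranspose_mul_self_eq_eucNorm_sq _ _).symm

/-- `S⁺` at `(U, δ)`, `δ ≥ 0`, gives the summit's matrix there. [folklore] -/
theorem summitAt_of_groundToGround {U δ : ℝ} (hδ : 0 ≤ δ) (h : GroundToGround U δ) : SummitAt U δ :=
  summitMatrix_of_everyGSOrder (everyGSOrder_of_groundToGround (by linarith) h)

/-- The `S⁺`-line for the crux: package ⇒ ground-to-ground coherence at some doping, for every `U` of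
the window, proves the crux (the `closes`-compatible form). [folklore] -/
theorem crux_of_groundToGroundWindow
    (h : ∀ U : ℝ, 12 ≤ U → U ≤ 24 → Pkg U → ∃ δ ∈ Set.Ioo (0 : ℝ) (1 / 2), GroundToGround U δ) :
    DiluteDWavePairsCondense :=
  crux_iff_window.2 fun U h12 h24 hP => by
    obtain ⟨δ, hδ, hG⟩ := h U h12 h24 hP
    exact ⟨δ, hδ, summitAt_of_groundToGround hδ.1.le hG⟩

/-! ## Strengthen ST-B — a finite-size criterion (schema) -/

/-- **Finite-size criterion at side `L₁` with threshold `κ`** (the Kennedy–Lieb–Shastry shape: a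
lower bound on the pair intensity of the ground states of ONE finite torus implies order at all larger
sides). In reflection-positive models such criteria are theorems (Gaussian domination supplies the
infrared bound, and only a short-distance floor remains to be checked); here it is a bare schema — no
instance `(L₁, κ)` is provable without an infrared bound for the `d`-wave pair structure factor of the
doped sector ground states. [folklore] -/
def FiniteSizeCriterion (U δ : ℝ) (L₁ : ℕ) [NeZero L₁] (κ : ℝ) : Prop :=
  (∀ ψ : Fock (Orb (FermionTorus 2 L₁)), star ψ ⬝ᵥ ψ = 1 →
      IsGroundStateInSector (hubbardTorus 2 L₁ 1 U) (2 * ⌊(1 - δ) * (L₁ : ℝ) ^ 2 / 2⌋₊) 0 ψ →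
        κ * (L₁ : ℝ) ^ 4 ≤ (expect ((pairField dWaveFormFactor L₁)ᴴ * pairField dWaveFormFactor L₁) ψ).re) →
    EveryGSOrder U δ

/-! ## Decomposition DE-A — the Legendre (susceptibility × coercivity) split -/

/-- A family of comparison operators `A_L` is `g/L²`-COERCIVE: `(g/L²)‖w‖² ≤ re⟨w, A_L w⟩` for all `w`.
(Intended instance: `A_L = H_L - E_ref(L)` with a reference energy `g/L²` below the bottom of the
relevant spectrum — the "tower gap floor".) [folklore] -/
def Coercive (A : ∀ L : ℕ, Matrix (Finset (Orb (FermionTorus 2 L))) (Finset (Orb (FermionTorus 2 L))) ℂ)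
    (g : ℝ) : Prop :=
  ∀ (L : ℕ) [NeZero L] (w : Fock (Orb (FermionTorus 2 L))),
    g / (L : ℝ) ^ 2 * (star w ⬝ᵥ w).re ≤ (star w ⬝ᵥ (A L *ᵥ w)).re

/-- The LEGENDRE (variational) form of a pair-susceptibility floor `⟨Δψ, A⁻¹ Δψ⟩ ≥ a L⁶` on every
sector ground state: some trial vector `w` achieves `2 re⟨w, Δψ⟩ - re⟨w, A w⟩ ≥ a L⁶`
(`sup_w [2 re⟨w, v⟩ - ⟨w, A w⟩] = ⟨v, A⁻¹ v⟩` for `A > 0`). [folklore] -/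
def LegendreFloor (A : ∀ L : ℕ, Matrix (Finset (Orb (FermionTorus 2 L))) (Finset (Orb (FermionTorus 2 L))) ℂ)
    (U δ a : ℝ) : Prop :=
  ∃ L₀ : ℕ, ∀ (L : ℕ) [NeZero L], L₀ ≤ L → Even L →
    ∀ ψ : Fock (Orb (FermionTorus 2 L)), star ψ ⬝ᵥ ψ = 1 →
      IsGroundStateInSector (hubbardTorus 2 L 1 U) (2 * ⌊(1 - δ) * (L : ℝ) ^ 2 / 2⌋₊) 0 ψ →
        ∃ w : Fock (Orb (FermionTorus 2 L)),
          a * (L : ℝ) ^ 6 ≤ 2 * (star w ⬝ᵥ (pairField dWaveFormFactor L *ᵥ ψ)).re - (star w ⬝ᵥ (A L *ᵥ w)).re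

/-- **The Legendre split closes** (AM–GM): a susceptibility floor `a L⁶` against a `g/L²`-coercive
comparison family gives the every-GS order floor `a g L⁴`. Proof:
`a L⁶ ≤ 2‖w‖‖Δψ‖ - (g/L²)‖w‖² ≤ (L²/g)‖Δψ‖²`. [folklore] -/
theorem everyGSOrder_of_legendre
    {A : ∀ L : ℕ, Matrix (Finset (Orb (FermionTorus 2 L))) (Finset (Orb (FermionTorus 2 L))) ℂ}
    {U δ a g : ℝ} (ha : 0 < a) (hg : 0 < g) (hA : Coercive A g) (hF : LegendreFloor A U δ a) :
    EveryGSOrder U δ := by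
  obtain ⟨L₀, hL⟩ := hF
  refine ⟨a * g, mul_pos ha hg, L₀, fun L _ hL₀ hE ψ hψ hgs => ?_⟩
  obtain ⟨w, hw⟩ := hL L hL₀ hE ψ hψ hgs
  set v := pairField dWaveFormFactor L *ᵥ ψ with hv
  have hLpos : (0 : ℝ) < (L : ℝ) := by exact_mod_cast Nat.pos_of_ne_zero (NeZero.ne L)
  set t : ℝ := g / (L : ℝ) ^ 2 with ht
  have htpos : 0 < t := by positivity
  -- x = ‖w‖, y = ‖v‖
  have hx : (star w ⬝ᵥ w).re = eucNorm w ^ 2 := (eucNorm_sq w).symm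
  have hy : (expect ((pairField dWaveFormFactor L)ᴴ * pairField dWaveFormFactor L) ψ).re = eucNorm v ^ 2 := by
    simp only [Literature.MathematicalPhysics.QuantumLattice.expect]
    exact re_expect_conjTranspose_mul_self_eq_eucNorm_sq _ _
  have hre : (star w ⬝ᵥ v).re ≤ eucNorm w * eucNorm v :=
    (Complex.re_le_norm _).trans (norm_star_dotProduct_le w v)
  have hcoer : t * eucNorm w ^ 2 ≤ (star w ⬝ᵥ (A L *ᵥ w)).re := by
    have := hA L w
    rwa [hx] at this
  -- a L⁶ ≤ 2xy - t x²
  have hmain : a * (L : ℝ) ^ 6 ≤ 2 * (eucNorm w * eucNorm v) - t * eucNorm w ^ 2 := by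
    linarith [hw, hre, hcoer]
  -- t (2xy - t x²) ≤ y²
  have hamgm : t * (2 * (eucNorm w * eucNorm v) - t * eucNorm w ^ 2) ≤ eucNorm v ^ 2 := by
    nlinarith [sq_nonneg (t * eucNorm w - eucNorm v)]
  have h6 : t * (a * (L : ℝ) ^ 6) ≤ eucNorm v ^ 2 :=
    (mul_le_mul_of_nonneg_left hmain htpos.le).trans hamgm
  have hid : t * (a * (L : ℝ) ^ 6) = a * g * (L : ℝ) ^ 4 := by
    rw [ht]
    field_simp
  rw [hy, ← hid]
  exact h6

/-! ## Decomposition (s1 D6, re-typed for the probes) — regime split in `U` -/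

/-- The crux restricted to the sub-window `[lo, hi]`. [folklore] -/
def CruxOn (lo hi : ℝ) : Prop :=
  ∀ U : ℝ, lo ≤ U → U ≤ hi → Pkg U → ∃ δ ∈ Set.Ioo (0 : ℝ) (1 / 2), SummitAt U δ

/-- `C = CruxOn 12 24`. [folklore] -/
theorem crux_iff_cruxOn : DiluteDWavePairsCondense ↔ CruxOn 12 24 := crux_iff_window

/-- Glue of the regime split at any cut `m`: `CruxOn 12 m → CruxOn m 24 → C`. [folklore] -/
theorem cruxOn_split (m : ℝ) (h₁ : CruxOn 12 m) (h₂ : CruxOn m 24) : DiluteDWavePairsCondense :=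
  crux_iff_cruxOn.2 fun U h12 h24 hP =>
    (le_total U m).elim (fun hm => h₁ U h12 hm hP) (fun hm => h₂ U hm h24 hP)

/-- Each piece is implied by the crux (restriction), so the split is honest only if a piece is
STRICTLY easier; see the census for why neither is. [folklore] -/
theorem cruxOn_of_crux {lo hi : ℝ} (hlo : 12 ≤ lo) (hhi : hi ≤ 24) (h : DiluteDWavePairsCondense) :
    CruxOn lo hi :=
  fun U hU₁ hU₂ hP => crux_iff_window.1 h U (hlo.trans hU₁) (hU₂.trans hhi) hP

/-! ## Negation — the shape of a counterexample -/

/-- A DARK LIT POINT: the package holds at `U` but NO doping in `(0, 1/2)` has the summit's order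
(e.g. a `d`-wave Cooper-pair Bose metal, or stripe / pair-density-wave ground states at every `δ`).
[folklore] -/
def DarkLitPoint (U : ℝ) : Prop :=
  Pkg U ∧ ∀ δ ∈ Set.Ioo (0 : ℝ) (1 / 2), ¬ SummitAt U δ

/-- **What a refutation must build:** `¬C ↔` a dark lit point in the window. [folklore] -/
theorem not_crux_iff_exists_darkLitPoint :
    ¬ DiluteDWavePairsCondense ↔ ∃ U : ℝ, 12 ≤ U ∧ U ≤ 24 ∧ DarkLitPoint U := by
  rw [crux_iff_window]
  constructor
  · intro h
    by_contra hne
    apply h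
    intro U h12 h24 hP
    by_contra hno
    push Not at hno
    exact hne ⟨U, h12, h24, hP, fun δ hδ hS => hno δ hδ hS⟩
  · rintro ⟨U, h12, h24, hP, hdark⟩ h
    obtain ⟨δ, hδ, hS⟩ := h U h12 h24 hP
    exact hdark δ hδ hS

/-- A dark lit point needs the package: off the lit set the crux is vacuous (landed dichotomy,
`diluteDWavePairsCondense_of_not_boundCoherentDWavePairs`). [folklore] -/
theorem crux_of_no_lit_point (h : ∀ U : ℝ, 12 ≤ U → U ≤ 24 → ¬ Pkg U) : DiluteDWavePairsCondense :=
  crux_iff_window.2 fun U h12 h24 hP => absurd hP (h U h12 h24)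

end Summit.HubbardSuperconductivity.HubbardSuperconductivity.Cruxes.DiluteDWavePairsCondense.CensusR1

end
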